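import Summits.QuantumFields.YangMills.Theorems.FluctuationComparisonRegPrIntLS2BetaPairingTangentSplit
import Summits.QuantumFields.YangMills.Theorems.FluctuationComparisonRegPrIntLS2BetaExcessSplit
import Mathlib.Analysis.SpecialFunctions.Exponential
import HarnessLib

/-!
# S2β · THE (A-C¹) LETTER OF CRIT-m♮ — «THE CHARTED WILSON ACTION IS SMOOTH AND ITS FIRST VARIATION IS THE PAIRING `DA(U₀)`»: `ζ ↦ A(expPoint(ζ)•U₀)` on the
# tangent space `PBond → ℝ³` is `C^∞`, STRICTLY differentiable at `0`, and `fderiv … 0 ζ = Σ_p ⟪imVec q(U₀∂p), Ad_{T₁}ζ(ℓ₁) + Ad_{T₂}ζ(ℓ₂) − Ad_{T₃}ζ(ℓ₃) − ζ(ℓ₄)⟫`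
# = ✓p822511 `tangentSplit`'s `DA(U₀)[ζ]` CHARACTER FOR CHARACTER — any background, any `Params`, any level, ZERO hypotheses

Cell `ym3-torus` (YM ladder rung R3 = continuum `SU(2)` Yang–Mills on the three-torus at fixed lattice data — a RUNG: NOT d = 4, NOT infinite volume, NOT a mass gap,
NOT Clay).  Width seat `ym3-torus-px5` (gen 22); the third piece of the CRIT-m♮ split (px16 g21 12:14:52Z «(A-C¹) strictness inside (α)'s instance file: GO»; INTENT
12:28:33Z); crux `stmt-QuantumFields-20520` (`…Theses.UnitScaleTilt.FluctuationComparisonRegPrIntL`), LINE g18-1 S2β, organ GAP♯∘ (registered `stub_uniformFibreGapOrbit`,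
registry UNTOUCHED) ⟸ (D♮) ∧ (F♮) ⟸ «CRIT♮» ∧ (BKG)✓p822405 ⟸ «MULT♭» = CRIT-m♮ ∧ MULT♮ ∧ AVG₂♭ (px16 g21 (3)∕(5)); CRIT-m♮ ⟸ (α) ✓p822961 ∘ {(β) ✓p822751, (SUBM-m),
(A-C¹) = THIS FILE}; `--kind proof --supports stmt-QuantumFields-20520 --as helper`, count-neutral, DEFINITION-FREE (0 `def`, 0 `instance`, 0 `notation`, 0 `sorry`,
default heartbeats).

THE CHART.  The right-invariant chart at `U₀` of px16 g21's (4)∕(5): `ζ : PBond P j → EuclideanSpace ℝ (Fin 3)` ↦ `fun ℓ => expPoint (ζ ℓ) * U₀ ℓ` (lit ✓`T4HaarSU2ExpChart.expPoint`,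
`su2Quat (expPoint x) = exp (imQuat x)`), so that `U ℓ·(U₀ ℓ)⁻¹ = expPoint (ζ ℓ)` and ✓p822511's relative coordinates `ξ_ℓ = imVec q(U ℓ·(U₀ ℓ)⁻¹)` are `ζ` to first order.

WHAT IS PROVED (sorry-free; used inline, no definition).
* §1 quaternion form: `star_imQuat`, `star_su2Quat_eq_inv`, `su2Quat_expPoint_mul`, `su2Quat_inv_expPoint_mul` (`q((expPoint x·g)⁻¹) = star q(g)·exp(−imQuat x)` — lit ✓`su2Quat_inv`, Mathlib
  `NormedSpace.star_exp`), `su2Quat_plaqHol_chart`, ★`wilsonAction4_chart_eq` (the charted action as `Σ_p (1 − re(four exponential factors))`).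
* §2 ★★`contDiff_wilsonAction4_chart` (`C^∞`: `NormedSpace.exp_analytic` on `ℍ` ∘ the linear `imQuat` ∘ coordinate projections, products, `re`), ★★`hasStrictFDerivAt_wilsonAction4_chart`
  (`ContDiffAt.hasStrictFDerivAt`).
* §3 line calculus [folklore]: `hasDerivAt_exp_imQuat_smul` (`d∕dt|₀ exp(imQuat(t•v)) = imQuat v`, Mathlib `hasDerivAt_exp_smul_const`), the conjugated factors through `1`,
  `hasDerivAt_mul_four_of_eq_one`, `hasDerivAt_re`, ★`plaqHol_chart_smul_eq` (= ✓p822511 `rel_plaqHol_eq_fourFactor` at `U := expPoint(t•ζ)•U₀`: the charted plaquette is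
  `P₀·(T₁e^{tζ₁}T₁⁻¹)(T₂e^{tζ₂}T₂⁻¹)(T₃e^{−tζ₃}T₃⁻¹)e^{−tζ₄}` with the partial transporters `T₁ = P₀⁻¹`, `T₂ = P₀⁻¹U₀(ℓ₁)`, `T₃ = P₀⁻¹U₀(ℓ₁)U₀(ℓ₂)U₀(ℓ₃)⁻¹`).
* §4 ★`sum_factorDerivs_eq` (the four factor derivatives sum to `imQuat` of the covariant curl, lit ✓`imQuat_adSU2`), ★★`hasDerivAt_re_fourFactor` (one plaquette, generic
  transporters: `d∕dt|₀ re(q(P₀)·Πfactors) = −⟪imVec q(P₀), Ad_{T₁}v₁ + Ad_{T₂}v₂ − Ad_{T₃}v₃ − v₄⟫` by ✓`re_mul_eq_sub_inner`, `imQuat_re`, `imVec_imQuat`),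
  ★★`hasDerivAt_one_sub_reTr_plaqHol_chart_smul`, ★★★`hasDerivAt_wilsonAction4_chart_smul` (the FIRST VARIATION along every line = `DA(U₀)[ζ]`),
  ★★★`fderiv_wilsonAction4_chart_apply` (`fderiv … 0 ζ = DA(U₀)[ζ]`, uniqueness along the line), ★★★`exists_hasStrictFDerivAt_wilsonAction4_chart` — **(A-C¹) in one
  statement: `∃ D, HasStrictFDerivAt (A∘chart_{U₀}) D 0 ∧ ∀ ζ, D ζ = DA(U₀)[ζ]`.**

SO.  With ✓p822961 (α) and ✓p822751 (β): **CRIT-m♮ ⟸ (SUBM-m) alone** («the charted `m`-fold descent is strictly differentiable at `0` with an ONTO derivative `DM(U₀)`»,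
the object RINV-cov ∕ AVG₂♭ quantify — px16 g21 ∕ px10 g23); the assembling instance door is the next file.  This also makes ✓p822511's docstring sentence «`DA(U₀)` IS the
differential of the Wilson action at `U₀` in the right-invariant chart» a KERNEL theorem.

HONEST.  Chart calculus over the tree's `SU(2)` quaternion API + Mathlib's exponential [folklore]; nothing of Bałaban's analysis; (SUBM-m), RINV-cov, AVG₂♭, MULT♮, CRIT-m♮ (for
the organ's `U₀`), «CRIT♮», (D♮)∕(F♮), GAP♯∘, the five REGISTERED stubs, S2β, crux 20520, 19936, 19200 and `YM3TorusSU2` are NOT proved; no summit statement is proved by a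
helper; rung R3 = SU(2) YM₃ on T³ at fixed lattice data — NOT d = 4, NOT infinite volume, NOT a mass gap, NOT Clay; the Yang–Mills mass gap is NOT proved.  Axioms standard.

References: T. Bałaban, CMP **102** (1985) 277–309 [Balaban1985Variational] ((26) p.284, (34) p.283: the first-order term of the plaquette expansion about a background — the
printed instance of this first variation); CMP **122** (1989) [Balaban1989LargeFieldI] ((1.77) p.194: `Ad` of the transporters); Mathlib `Analysis.SpecialFunctions.Exponential`.
-/

set_option autoImplicit false

noncomputable section

open scoped Quaternion RealInnerProductSpace
open Literature.MathematicalPhysics.QuantumLattice (su2Quat norm_su2Quat su2Quat_ne_zero)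
open Literature.MathematicalPhysics.QuantumFieldTheory.Balaban1983to89
open Literature.MathematicalPhysics.QuantumFieldTheory.Balaban1983to89.T4CubeChartGnomonic (SU2)
open Literature.MathematicalPhysics.QuantumFieldTheory.Balaban1983to89.T4HaarSU2ExpChart (expPoint imQuat imQuat_re su2Quat_expPoint)
open Literature.MathematicalPhysics.QuantumFieldTheory.Balaban1983to89.T4HaarSU2Translate (su2Quat_mul su2Quat_one)
open Literature.MathematicalPhysics.QuantumFieldTheory.Balaban1983to89.T4WilsonLinkAffine (su2Quat_inv)
open Literature.MathematicalPhysics.QuantumFieldTheory.Balaban1983to89.T4GnomonicWilsonHessian (reTr_eq_re_su2Quat)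
open Literature.MathematicalPhysics.QuantumFieldTheory.Balaban1983to89.T4ExpWindowSmallField (imVec imQuat_imVec)
open Literature.MathematicalPhysics.QuantumFieldTheory.Balaban1983to89.B15Prop1ChartSU2 (adSU2 adSU2_apply)
open Literature.MathematicalPhysics.QuantumFieldTheory.Balaban1983to89.B15Prop1ChartCalculusSU2 (imVecL imVecL_apply imVec_imQuat imQuat_adSU2)
open Summit.QuantumFields.YangMills.Theorems.FluctuationComparisonRegPrIntLS2BetaExcessSplit (re_mul_eq_sub_inner)
open GaugeField (plaqHol)

namespace Summit.QuantumFields.YangMills.Theorems.FluctuationComparisonRegPrIntLS2BetaWilsonActionChartDeriv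

/-! ## §1 The charted plaquette in quaternions -/

section Quat

variable {P : Params} {j : ℕ}

/-- `star (imQuat v) = −imQuat v` (purely imaginary). [folklore] -/
theorem star_imQuat (v : EuclideanSpace ℝ (Fin 3)) : star (imQuat v) = -imQuat v := by
  have h := imQuat_re v
  ext <;> simp [h]

/-- `q(expPoint x · g) = exp(imQuat x) · q(g)`. [folklore] -/
theorem su2Quat_expPoint_mul (x : EuclideanSpace ℝ (Fin 3)) (g : SU2) :
    su2Quat (expPoint x * g) = NormedSpace.exp (imQuat x) * su2Quat g := by
  rw [su2Quat_mul, su2Quat_expPoint]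

/-- `q((expPoint x · g)⁻¹) = star q(g) · exp(−imQuat x)`. [folklore] -/
theorem su2Quat_inv_expPoint_mul (x : EuclideanSpace ℝ (Fin 3)) (g : SU2) :
    su2Quat ((expPoint x * g)⁻¹) = star (su2Quat g) * NormedSpace.exp (-imQuat x) := by
  rw [su2Quat_inv, su2Quat_mul, su2Quat_expPoint, star_mul, NormedSpace.star_exp, star_imQuat]

/-- The charted plaquette holonomy as a product of four quaternion factors. [folklore] -/
theorem su2Quat_plaqHol_chart (U₀ : GaugeField P j SU2) (ζ : PBond P j → EuclideanSpace ℝ (Fin 3)) (p : Plaq P j) :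
    su2Quat (plaqHol (fun ℓ => expPoint (ζ ℓ) * U₀ ℓ) p) =
      (NormedSpace.exp (imQuat (ζ ⟨p.src, p.μ⟩)) * su2Quat (U₀ ⟨p.src, p.μ⟩)) *
        (NormedSpace.exp (imQuat (ζ ⟨p.src.shift p.μ, p.ν⟩)) * su2Quat (U₀ ⟨p.src.shift p.μ, p.ν⟩)) *
        (star (su2Quat (U₀ ⟨p.src.shift p.ν, p.μ⟩)) * NormedSpace.exp (-imQuat (ζ ⟨p.src.shift p.ν, p.μ⟩))) *
        (star (su2Quat (U₀ ⟨p.src, p.ν⟩)) * NormedSpace.exp (-imQuat (ζ ⟨p.src, p.ν⟩))) := by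
  simp only [plaqHol, su2Quat_mul, su2Quat_inv_expPoint_mul, su2Quat_expPoint]

/-- The charted Wilson action as a real function of the tangent field. [folklore] -/
theorem wilsonAction4_chart_eq (U₀ : GaugeField P j SU2) (ζ : PBond P j → EuclideanSpace ℝ (Fin 3)) :
    wilsonAction4 (fun ℓ => expPoint (ζ ℓ) * U₀ ℓ) =
      ∑ p : Plaq P j, (1 - ((NormedSpace.exp (imQuat (ζ ⟨p.src, p.μ⟩)) * su2Quat (U₀ ⟨p.src, p.μ⟩)) *
        (NormedSpace.exp (imQuat (ζ ⟨p.src.shift p.μ, p.ν⟩)) * su2Quat (U₀ ⟨p.src.shift p.μ, p.ν⟩)) *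
        (star (su2Quat (U₀ ⟨p.src.shift p.ν, p.μ⟩)) * NormedSpace.exp (-imQuat (ζ ⟨p.src.shift p.ν, p.μ⟩))) *
        (star (su2Quat (U₀ ⟨p.src, p.ν⟩)) * NormedSpace.exp (-imQuat (ζ ⟨p.src, p.ν⟩)))).re) := by
  simp only [wilsonAction4, wilsonAction, one_mul, reTr_eq_re_su2Quat, su2Quat_plaqHol_chart]

end Quat

/-! ## §2 Smoothness of the charted action -/

section Smooth

variable {P : Params} {j : ℕ}

/-- `x ↦ exp(imQuat x)` is smooth. [folklore] -/
theorem contDiff_exp_imQuat {n : WithTop ℕ∞} : ContDiff ℝ n (fun x : EuclideanSpace ℝ (Fin 3) => NormedSpace.exp (imQuat x)) := by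
  have h1 : ContDiff ℝ n (fun q : ℍ => NormedSpace.exp q) :=
    (AnalyticOnNhd.contDiff (fun q _ => NormedSpace.exp_analytic (𝕂 := ℝ) q))
  have h2 : ContDiff ℝ n (fun x : EuclideanSpace ℝ (Fin 3) => imQuat x) :=
    (LinearMap.toContinuousLinearMap imQuat).contDiff
  exact h1.comp h2

/-- `x ↦ exp(−imQuat x)` is smooth. [folklore] -/
theorem contDiff_exp_neg_imQuat {n : WithTop ℕ∞} : ContDiff ℝ n (fun x : EuclideanSpace ℝ (Fin 3) => NormedSpace.exp (-imQuat x)) := by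
  have h : (fun x : EuclideanSpace ℝ (Fin 3) => NormedSpace.exp (-imQuat x)) = fun x => NormedSpace.exp (imQuat (-x)) := by
    funext x; rw [map_neg]
  rw [h]
  exact contDiff_exp_imQuat.comp contDiff_neg

/-- ★★ **THE CHARTED WILSON ACTION IS SMOOTH**: `ζ ↦ A(expPoint(ζ)·U₀)` is `C^∞` on the tangent space `PBond → ℝ³` (any background, any `Params`, any level).
[folklore] -/
theorem contDiff_wilsonAction4_chart (U₀ : GaugeField P j SU2) {n : WithTop ℕ∞} :
    ContDiff ℝ n (fun ζ : PBond P j → EuclideanSpace ℝ (Fin 3) => wilsonAction4 (fun ℓ => expPoint (ζ ℓ) * U₀ ℓ)) := by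
  have hfun : (fun ζ : PBond P j → EuclideanSpace ℝ (Fin 3) => wilsonAction4 (fun ℓ => expPoint (ζ ℓ) * U₀ ℓ)) =
      fun ζ => ∑ p : Plaq P j, (1 - ((NormedSpace.exp (imQuat (ζ ⟨p.src, p.μ⟩)) * su2Quat (U₀ ⟨p.src, p.μ⟩)) *
        (NormedSpace.exp (imQuat (ζ ⟨p.src.shift p.μ, p.ν⟩)) * su2Quat (U₀ ⟨p.src.shift p.μ, p.ν⟩)) *
        (star (su2Quat (U₀ ⟨p.src.shift p.ν, p.μ⟩)) * NormedSpace.exp (-imQuat (ζ ⟨p.src.shift p.ν, p.μ⟩))) *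
        (star (su2Quat (U₀ ⟨p.src, p.ν⟩)) * NormedSpace.exp (-imQuat (ζ ⟨p.src, p.ν⟩)))).re) := by
    funext ζ; exact wilsonAction4_chart_eq U₀ ζ
  rw [hfun]
  refine ContDiff.sum fun p _ => contDiff_const.sub ?_
  -- `re : ℍ → ℝ` is a continuous linear map (landed elsewhere as `VirialFluxGap.AnchorSlice.contDiff_quat_re`; inlined to keep the imports local)
  have hre : ContDiff ℝ n (fun q : ℍ => q.re) :=
    (LinearMap.toContinuousLinearMap (⟨⟨fun q : ℍ => q.re, fun _ _ => rfl⟩, fun _ _ => rfl⟩ : ℍ →ₗ[ℝ] ℝ)).contDiff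
  refine hre.comp ?_
  have hE : ∀ ℓ : PBond P j, ContDiff ℝ n (fun ζ : PBond P j → EuclideanSpace ℝ (Fin 3) => NormedSpace.exp (imQuat (ζ ℓ))) :=
    fun ℓ => contDiff_exp_imQuat.comp (contDiff_apply ℝ (EuclideanSpace ℝ (Fin 3)) ℓ)
  have hEn : ∀ ℓ : PBond P j, ContDiff ℝ n (fun ζ : PBond P j → EuclideanSpace ℝ (Fin 3) => NormedSpace.exp (-imQuat (ζ ℓ))) :=
    fun ℓ => contDiff_exp_neg_imQuat.comp (contDiff_apply ℝ (EuclideanSpace ℝ (Fin 3)) ℓ)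
  exact ((((hE _).mul contDiff_const).mul ((hE _).mul contDiff_const)).mul (contDiff_const.mul (hEn _))).mul
    (contDiff_const.mul (hEn _))

/-- ★★ **STRICT DIFFERENTIABILITY AT THE BASE POINT** (the (A-C¹) letter's regularity half): the charted action is strictly differentiable at `ζ = 0`
with derivative `fderiv`. [folklore] -/
theorem hasStrictFDerivAt_wilsonAction4_chart (U₀ : GaugeField P j SU2) :
    HasStrictFDerivAt (fun ζ : PBond P j → EuclideanSpace ℝ (Fin 3) => wilsonAction4 (fun ℓ => expPoint (ζ ℓ) * U₀ ℓ))
      (fderiv ℝ (fun ζ : PBond P j → EuclideanSpace ℝ (Fin 3) => wilsonAction4 (fun ℓ => expPoint (ζ ℓ) * U₀ ℓ)) 0) 0 :=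
  ((contDiff_wilsonAction4_chart U₀ (n := ⊤)).contDiffAt).hasStrictFDerivAt (by simp)

end Smooth

/-! ## §3 The derivative along lines: the first variation IS the pairing `DA(U₀)` of ✓p822511 -/

section Line

variable {P : Params} {j : ℕ}

/-- `star q(g) = q(g)⁻¹` (`q(g⁻¹) = star q(g)` — lit ✓`su2Quat_inv` — and `q(g⁻¹) = q(g)⁻¹` by multiplicativity; the latter is landed elsewhere as
`FemtoTransferGap.TwoLattice.ConstTube.su2Quat_inv'`, inlined here to keep the imports local). [folklore] -/
theorem star_su2Quat_eq_inv (g : SU2) : star (su2Quat g) = (su2Quat g)⁻¹ := by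
  rw [← su2Quat_inv]
  exact eq_inv_of_mul_eq_one_right (by rw [← su2Quat_mul, mul_inv_cancel, su2Quat_one])


/-- The exponential of a line of imaginary quaternions has derivative `imQuat v` at `0`. [folklore] -/
theorem hasDerivAt_exp_imQuat_smul (v : EuclideanSpace ℝ (Fin 3)) :
    HasDerivAt (fun t : ℝ => NormedSpace.exp (imQuat (t • v))) (imQuat v) 0 := by
  have h := hasDerivAt_exp_smul_const (𝕂 := ℝ) (imQuat v) (0 : ℝ)
  simp only [zero_smul, NormedSpace.exp_zero, one_mul] at h
  have hfun : (fun t : ℝ => NormedSpace.exp (imQuat (t • v))) = fun u : ℝ => NormedSpace.exp (u • imQuat v) := by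
    funext t; rw [map_smul]
  rw [hfun]; exact h

/-- The same for the inverse branch `exp(−imQuat(t•v))`. [folklore] -/
theorem hasDerivAt_exp_neg_imQuat_smul (v : EuclideanSpace ℝ (Fin 3)) :
    HasDerivAt (fun t : ℝ => NormedSpace.exp (-imQuat (t • v))) (-imQuat v) 0 := by
  have h := hasDerivAt_exp_imQuat_smul (-v)
  have hfun : (fun t : ℝ => NormedSpace.exp (-imQuat (t • v))) = fun t : ℝ => NormedSpace.exp (imQuat (t • (-v))) := by
    funext t; rw [smul_neg, map_neg]
  rw [hfun, ← map_neg]; exact h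

/-- A conjugated exponential factor `τ·exp(±imQuat(t•v))·star τ` has value `1` at `t = 0` and derivative `τ·(±imQuat v)·star τ`. [folklore] -/
theorem hasDerivAt_conj_exp (T : SU2) (v : EuclideanSpace ℝ (Fin 3)) :
    HasDerivAt (fun t : ℝ => su2Quat T * NormedSpace.exp (imQuat (t • v)) * star (su2Quat T))
      (su2Quat T * imQuat v * star (su2Quat T)) 0 :=
  ((hasDerivAt_exp_imQuat_smul v).const_mul (su2Quat T)).mul_const (star (su2Quat T))

/-- The inverse branch of `hasDerivAt_conj_exp`. [folklore] -/
theorem hasDerivAt_conj_exp_neg (T : SU2) (v : EuclideanSpace ℝ (Fin 3)) :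
    HasDerivAt (fun t : ℝ => su2Quat T * NormedSpace.exp (-imQuat (t • v)) * star (su2Quat T))
      (su2Quat T * (-imQuat v) * star (su2Quat T)) 0 :=
  ((hasDerivAt_exp_neg_imQuat_smul v).const_mul (su2Quat T)).mul_const (star (su2Quat T))

/-- Product rule for four factors through `1`: the derivative of the product is the SUM of the derivatives. [folklore] -/
theorem hasDerivAt_mul_four_of_eq_one {g₁ g₂ g₃ g₄ : ℝ → ℍ} {d₁ d₂ d₃ d₄ : ℍ}
    (h₁ : HasDerivAt g₁ d₁ 0) (h₂ : HasDerivAt g₂ d₂ 0) (h₃ : HasDerivAt g₃ d₃ 0) (h₄ : HasDerivAt g₄ d₄ 0)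
    (e₁ : g₁ 0 = 1) (e₂ : g₂ 0 = 1) (e₃ : g₃ 0 = 1) (e₄ : g₄ 0 = 1) :
    HasDerivAt (fun t => g₁ t * g₂ t * g₃ t * g₄ t) (d₁ + d₂ + d₃ + d₄) 0 := by
  have h := ((h₁.mul h₂).mul h₃).mul h₄
  simp only [Pi.mul_apply, e₁, e₂, e₃, e₄, mul_one, one_mul] at h
  exact h

/-- `re` along a differentiable quaternion curve. [folklore] -/
theorem hasDerivAt_re {f : ℝ → ℍ} {f' : ℍ} {x : ℝ} (h : HasDerivAt f f' x) :
    HasDerivAt (fun t => (f t).re) f'.re x := by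
  have hL := (LinearMap.toContinuousLinearMap (⟨⟨fun q : ℍ => q.re, fun _ _ => rfl⟩, fun _ _ => rfl⟩ : ℍ →ₗ[ℝ] ℝ)).hasFDerivAt.comp_hasDerivAt x h
  exact hL

/-- ★ **THE CHARTED PLAQUETTE ALONG A LINE, FACTORED THROUGH THE BACKGROUND** (✓p822511 `rel_plaqHol_eq_fourFactor` at `U := expPoint(t•ζ)•U₀`): with
`P₀ := U₀(∂p)` and the partial transporters `T₁ = P₀⁻¹`, `T₂ = P₀⁻¹U₀(ℓ₁)`, `T₃ = P₀⁻¹U₀(ℓ₁)U₀(ℓ₂)U₀(ℓ₃)⁻¹`,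
`U_t(∂p) = P₀·(T₁e^{tζ₁}T₁⁻¹)(T₂e^{tζ₂}T₂⁻¹)(T₃e^{−tζ₃}T₃⁻¹)e^{−tζ₄}`. [folklore] -/
theorem plaqHol_chart_smul_eq (U₀ : GaugeField P j SU2) (ζ : PBond P j → EuclideanSpace ℝ (Fin 3)) (p : Plaq P j) (t : ℝ) :
    plaqHol (fun ℓ => expPoint ((t • ζ) ℓ) * U₀ ℓ) p =
      plaqHol U₀ p *
        ((plaqHol U₀ p)⁻¹ * expPoint (t • ζ ⟨p.src, p.μ⟩) * (plaqHol U₀ p)⁻¹⁻¹ *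
          ((plaqHol U₀ p)⁻¹ * U₀ ⟨p.src, p.μ⟩ * expPoint (t • ζ ⟨p.src.shift p.μ, p.ν⟩) * ((plaqHol U₀ p)⁻¹ * U₀ ⟨p.src, p.μ⟩)⁻¹) *
          ((plaqHol U₀ p)⁻¹ * U₀ ⟨p.src, p.μ⟩ * U₀ ⟨p.src.shift p.μ, p.ν⟩ * (U₀ ⟨p.src.shift p.ν, p.μ⟩)⁻¹ *
              (expPoint (t • ζ ⟨p.src.shift p.ν, p.μ⟩))⁻¹ *
            ((plaqHol U₀ p)⁻¹ * U₀ ⟨p.src, p.μ⟩ * U₀ ⟨p.src.shift p.μ, p.ν⟩ * (U₀ ⟨p.src.shift p.ν, p.μ⟩)⁻¹)⁻¹) *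
          (expPoint (t • ζ ⟨p.src, p.ν⟩))⁻¹) := by
  have h := Summit.QuantumFields.YangMills.Theorems.FluctuationComparisonRegPrIntLS2BetaPairingTangentSplit.rel_plaqHol_eq_fourFactor
    (fun ℓ => expPoint ((t • ζ) ℓ) * U₀ ℓ) U₀ p
  simp only [Pi.smul_apply, mul_inv_cancel_right] at h
  rw [← h, mul_inv_cancel_left]
  rfl

end Line

/-! ## §4 The first variation: derivative of the charted action along lines = the pairing `DA(U₀)` -/

section Variation

variable {P : Params} {j : ℕ}

/-- The sum of the four factor derivatives is `imQuat` of the covariant curl `Ad_{T₁}v₁ + Ad_{T₂}v₂ − Ad_{T₃}v₃ − v₄`. [folklore] -/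
theorem sum_factorDerivs_eq (T₁ T₂ T₃ : SU2) (v₁ v₂ v₃ v₄ : EuclideanSpace ℝ (Fin 3)) :
    su2Quat T₁ * imQuat v₁ * star (su2Quat T₁) + su2Quat T₂ * imQuat v₂ * star (su2Quat T₂) +
        su2Quat T₃ * (-imQuat v₃) * star (su2Quat T₃) + (-imQuat v₄) =
      imQuat (adSU2 T₁ v₁ + adSU2 T₂ v₂ - adSU2 T₃ v₃ - v₄) := by
  simp only [map_add, map_sub, imQuat_adSU2, star_su2Quat_eq_inv, mul_neg, neg_mul]
  abel

/-- ★ **ONE PLAQUETTE, GENERIC TRANSPORTERS**: the derivative at `0` of `t ↦ re(q(P₀)·(τ₁e^{t v₁}τ̄₁)(τ₂e^{t v₂}τ̄₂)(τ₃e^{−t v₃}τ̄₃)e^{−t v₄})` is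
`−⟪imVec q(P₀), Ad_{T₁}v₁ + Ad_{T₂}v₂ − Ad_{T₃}v₃ − v₄⟫`. [folklore] -/
theorem hasDerivAt_re_fourFactor (P₀ T₁ T₂ T₃ : SU2) (v₁ v₂ v₃ v₄ : EuclideanSpace ℝ (Fin 3)) :
    HasDerivAt (fun t : ℝ => (su2Quat P₀ *
        ((su2Quat T₁ * NormedSpace.exp (imQuat (t • v₁)) * star (su2Quat T₁)) *
          (su2Quat T₂ * NormedSpace.exp (imQuat (t • v₂)) * star (su2Quat T₂)) *
          (su2Quat T₃ * NormedSpace.exp (-imQuat (t • v₃)) * star (su2Quat T₃)) *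
          NormedSpace.exp (-imQuat (t • v₄)))).re)
      (-(inner ℝ (imVec (su2Quat P₀)) (adSU2 T₁ v₁ + adSU2 T₂ v₂ - adSU2 T₃ v₃ - v₄))) 0 := by
  have hprod := hasDerivAt_mul_four_of_eq_one (hasDerivAt_conj_exp T₁ v₁) (hasDerivAt_conj_exp T₂ v₂)
    (hasDerivAt_conj_exp_neg T₃ v₃) (hasDerivAt_exp_neg_imQuat_smul v₄)
    (by simp [star_su2Quat_eq_inv, su2Quat_ne_zero]) (by simp [star_su2Quat_eq_inv, su2Quat_ne_zero])
    (by simp [star_su2Quat_eq_inv, su2Quat_ne_zero]) (by simp)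
  have hre := hasDerivAt_re (hprod.const_mul (su2Quat P₀))
  rw [sum_factorDerivs_eq, re_mul_eq_sub_inner, imQuat_re, mul_zero, zero_sub, imVec_imQuat] at hre
  exact hre

/-- ★ **ONE PLAQUETTE OF THE CHARTED FIELD**: `t ↦ 1 − reTr((expPoint(t•ζ)•U₀)(∂p))` has derivative `⟪imVec q(U₀∂p), L_p(ζ)⟫` at `0`, with `L_p` the covariant
curl of ✓p822511. [folklore] -/
theorem hasDerivAt_one_sub_reTr_plaqHol_chart_smul (U₀ : GaugeField P j SU2) (ζ : PBond P j → EuclideanSpace ℝ (Fin 3)) (p : Plaq P j) :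
    HasDerivAt (fun t : ℝ => 1 - reTr (plaqHol (fun ℓ => expPoint ((t • ζ) ℓ) * U₀ ℓ) p))
      (inner ℝ (imVec (su2Quat (plaqHol U₀ p)))
        (adSU2 (plaqHol U₀ p)⁻¹ (ζ ⟨p.src, p.μ⟩) + adSU2 ((plaqHol U₀ p)⁻¹ * U₀ ⟨p.src, p.μ⟩) (ζ ⟨p.src.shift p.μ, p.ν⟩) -
          adSU2 ((plaqHol U₀ p)⁻¹ * U₀ ⟨p.src, p.μ⟩ * U₀ ⟨p.src.shift p.μ, p.ν⟩ * (U₀ ⟨p.src.shift p.ν, p.μ⟩)⁻¹) (ζ ⟨p.src.shift p.ν, p.μ⟩) -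
          ζ ⟨p.src, p.ν⟩)) 0 := by
  have h := hasDerivAt_re_fourFactor (plaqHol U₀ p) (plaqHol U₀ p)⁻¹ ((plaqHol U₀ p)⁻¹ * U₀ ⟨p.src, p.μ⟩)
    ((plaqHol U₀ p)⁻¹ * U₀ ⟨p.src, p.μ⟩ * U₀ ⟨p.src.shift p.μ, p.ν⟩ * (U₀ ⟨p.src.shift p.ν, p.μ⟩)⁻¹)
    (ζ ⟨p.src, p.μ⟩) (ζ ⟨p.src.shift p.μ, p.ν⟩) (ζ ⟨p.src.shift p.ν, p.μ⟩) (ζ ⟨p.src, p.ν⟩)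
  have hfun : (fun t : ℝ => 1 - reTr (plaqHol (fun ℓ => expPoint ((t • ζ) ℓ) * U₀ ℓ) p)) =
      fun t : ℝ => 1 - (su2Quat (plaqHol U₀ p) *
        ((su2Quat (plaqHol U₀ p)⁻¹ * NormedSpace.exp (imQuat (t • ζ ⟨p.src, p.μ⟩)) * star (su2Quat (plaqHol U₀ p)⁻¹)) *
          (su2Quat ((plaqHol U₀ p)⁻¹ * U₀ ⟨p.src, p.μ⟩) * NormedSpace.exp (imQuat (t • ζ ⟨p.src.shift p.μ, p.ν⟩)) *
              star (su2Quat ((plaqHol U₀ p)⁻¹ * U₀ ⟨p.src, p.μ⟩))) *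
          (su2Quat ((plaqHol U₀ p)⁻¹ * U₀ ⟨p.src, p.μ⟩ * U₀ ⟨p.src.shift p.μ, p.ν⟩ * (U₀ ⟨p.src.shift p.ν, p.μ⟩)⁻¹) *
                NormedSpace.exp (-imQuat (t • ζ ⟨p.src.shift p.ν, p.μ⟩)) *
              star (su2Quat ((plaqHol U₀ p)⁻¹ * U₀ ⟨p.src, p.μ⟩ * U₀ ⟨p.src.shift p.μ, p.ν⟩ * (U₀ ⟨p.src.shift p.ν, p.μ⟩)⁻¹))) *
          NormedSpace.exp (-imQuat (t • ζ ⟨p.src, p.ν⟩)))).re := by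
    funext t
    rw [reTr_eq_re_su2Quat, plaqHol_chart_smul_eq]
    simp only [su2Quat_mul, su2Quat_inv, star_mul, star_star, su2Quat_expPoint, NormedSpace.star_exp, star_imQuat, mul_assoc]
  rw [hfun]
  exact h.const_sub 1 |>.congr_deriv (by ring)

/-- ★★★ **THE FIRST VARIATION OF THE WILSON ACTION IN THE RIGHT-INVARIANT CHART IS THE PAIRING `DA(U₀)`** (the (A-C¹) letter's VALUE half, for ANY background `U₀`,
any `Params`, any level): along every line `t ↦ expPoint(t•ζ)•U₀`,
`d∕dt|₀ A = Σ_p ⟪imVec q(U₀∂p), Ad_{T₁}ζ(ℓ₁) + Ad_{T₂}ζ(ℓ₂) − Ad_{T₃}ζ(ℓ₃) − ζ(ℓ₄)⟫` — ✓p822511 `tangentSplit`'s `DA(U₀)[ζ]` CHARACTER FOR CHARACTER. [folklore] -/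
theorem hasDerivAt_wilsonAction4_chart_smul (U₀ : GaugeField P j SU2) (ζ : PBond P j → EuclideanSpace ℝ (Fin 3)) :
    HasDerivAt (fun t : ℝ => wilsonAction4 (fun ℓ => expPoint ((t • ζ) ℓ) * U₀ ℓ))
      (∑ p : Plaq P j, inner ℝ (imVec (su2Quat (GaugeField.plaqHol U₀ p)))
        (adSU2 (GaugeField.plaqHol U₀ p)⁻¹ (ζ ⟨p.src, p.μ⟩) + adSU2 ((GaugeField.plaqHol U₀ p)⁻¹ * U₀ ⟨p.src, p.μ⟩) (ζ ⟨p.src.shift p.μ, p.ν⟩) -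
          adSU2 ((GaugeField.plaqHol U₀ p)⁻¹ * U₀ ⟨p.src, p.μ⟩ * U₀ ⟨p.src.shift p.μ, p.ν⟩ * (U₀ ⟨p.src.shift p.ν, p.μ⟩)⁻¹) (ζ ⟨p.src.shift p.ν, p.μ⟩) -
          ζ ⟨p.src, p.ν⟩)) 0 := by
  have hfun : (fun t : ℝ => wilsonAction4 (fun ℓ => expPoint ((t • ζ) ℓ) * U₀ ℓ)) =
      fun t : ℝ => ∑ p : Plaq P j, (1 - reTr (plaqHol (fun ℓ => expPoint ((t • ζ) ℓ) * U₀ ℓ) p)) := by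
    funext t; simp only [wilsonAction4, wilsonAction, one_mul]
  rw [hfun]
  exact HasDerivAt.fun_sum fun p _ => hasDerivAt_one_sub_reTr_plaqHol_chart_smul U₀ ζ p

/-- ★★★ **THE FRÉCHET DERIVATIVE OF THE CHARTED ACTION AT THE BASE POINT IS `DA(U₀)`**: for every tangent field `ζ`,
`fderiv ℝ (ζ ↦ A(expPoint(ζ)•U₀)) 0 ζ = DA(U₀)[ζ]` (✓p822511's pairing; uniqueness of the derivative along the line through `ζ`). [folklore] -/
theorem fderiv_wilsonAction4_chart_apply (U₀ : GaugeField P j SU2) (ζ : PBond P j → EuclideanSpace ℝ (Fin 3)) :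
    fderiv ℝ (fun ζ' : PBond P j → EuclideanSpace ℝ (Fin 3) => wilsonAction4 (fun ℓ => expPoint (ζ' ℓ) * U₀ ℓ)) 0 ζ =
      ∑ p : Plaq P j, inner ℝ (imVec (su2Quat (GaugeField.plaqHol U₀ p)))
        (adSU2 (GaugeField.plaqHol U₀ p)⁻¹ (ζ ⟨p.src, p.μ⟩) + adSU2 ((GaugeField.plaqHol U₀ p)⁻¹ * U₀ ⟨p.src, p.μ⟩) (ζ ⟨p.src.shift p.μ, p.ν⟩) -
          adSU2 ((GaugeField.plaqHol U₀ p)⁻¹ * U₀ ⟨p.src, p.μ⟩ * U₀ ⟨p.src.shift p.μ, p.ν⟩ * (U₀ ⟨p.src.shift p.ν, p.μ⟩)⁻¹) (ζ ⟨p.src.shift p.ν, p.μ⟩) -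
          ζ ⟨p.src, p.ν⟩) := by
  have hF := (hasStrictFDerivAt_wilsonAction4_chart U₀).hasFDerivAt
  have hline : HasDerivAt (fun t : ℝ => t • ζ) ζ 0 := by
    simpa using (hasDerivAt_id (0 : ℝ)).smul_const ζ
  have hF' : HasFDerivAt (fun ζ' : PBond P j → EuclideanSpace ℝ (Fin 3) => wilsonAction4 (fun ℓ => expPoint (ζ' ℓ) * U₀ ℓ))
      (fderiv ℝ (fun ζ' : PBond P j → EuclideanSpace ℝ (Fin 3) => wilsonAction4 (fun ℓ => expPoint (ζ' ℓ) * U₀ ℓ)) 0)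
      ((fun t : ℝ => t • ζ) 0) := by
    simpa using hF
  have hcomp := hF'.comp_hasDerivAt (0 : ℝ) hline
  have hval := hasDerivAt_wilsonAction4_chart_smul U₀ ζ
  exact hcomp.unique hval

/-- ★★★ **THE (A-C¹) LETTER IN ONE STATEMENT**: the charted Wilson action `ζ ↦ A(expPoint(ζ)•U₀)` is STRICTLY differentiable at `0` with a derivative `D` whose value on
every tangent field is ✓p822511's pairing `DA(U₀)[ζ]` — the hypothesis shape the CRIT-m♮ Lagrange door (✓p822961 `exists_fun_eq_comp_of_isLocalMinOn`) consumes, for ANY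
background (no window, no argmin, any `Params`, any level). [folklore] -/
theorem exists_hasStrictFDerivAt_wilsonAction4_chart (U₀ : GaugeField P j SU2) :
    ∃ D : (PBond P j → EuclideanSpace ℝ (Fin 3)) →L[ℝ] ℝ,
      HasStrictFDerivAt (fun ζ : PBond P j → EuclideanSpace ℝ (Fin 3) => wilsonAction4 (fun ℓ => expPoint (ζ ℓ) * U₀ ℓ)) D 0 ∧
      ∀ ζ : PBond P j → EuclideanSpace ℝ (Fin 3), D ζ =
        ∑ p : Plaq P j, inner ℝ (imVec (su2Quat (GaugeField.plaqHol U₀ p)))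
          (adSU2 (GaugeField.plaqHol U₀ p)⁻¹ (ζ ⟨p.src, p.μ⟩) + adSU2 ((GaugeField.plaqHol U₀ p)⁻¹ * U₀ ⟨p.src, p.μ⟩) (ζ ⟨p.src.shift p.μ, p.ν⟩) -
            adSU2 ((GaugeField.plaqHol U₀ p)⁻¹ * U₀ ⟨p.src, p.μ⟩ * U₀ ⟨p.src.shift p.μ, p.ν⟩ * (U₀ ⟨p.src.shift p.ν, p.μ⟩)⁻¹) (ζ ⟨p.src.shift p.ν, p.μ⟩) -
            ζ ⟨p.src, p.ν⟩) :=
  ⟨_, hasStrictFDerivAt_wilsonAction4_chart U₀, fderiv_wilsonAction4_chart_apply U₀⟩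

end Variation

end Summit.QuantumFields.YangMills.Theorems.FluctuationComparisonRegPrIntLS2BetaWilsonActionChartDeriv

end
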